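import Summits.Ventures.PercRepro.C041TriDomTwoExitCount

/-!
# ROW C-041 — THE FAR SIDE OF A 2-CUT, III: THE GENERIC 2-CUT COUNT
(p6, gen 46; P6-TWOEXIT-LEAN.md §53 ADDENDUM 18)

A statement about counting alone.  The colourings are split along an edge predicate `In` (the far side) into an
outside part `o` and an inside part `i`; a distinguished outside edge `c₀` (the CHORD) and two «far connectivities»
`r i`, `bl i` read on the inside part sort the inside parts into four TYPES: `N` (neither), `D` (both), `R` (red
only), `B` (blue only).  A predicate `P` on colourings is CUT-RELATED (`CutRel`) to three outside-only predicates
`PN, PD, PC` if on the `N`-fibres it is `PN` of the outside part, on the `D`-fibres `PD`, and on the `R`/`B`-fibres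
`PC` of the outside part with the chord coloured by `r i`.  **THE 2-CUT COUNT** (`dom_of_twoCut_count`): if `P, Q`
are cut-related to `(PN, PD, PC)`, `(QN, QD, QC)`, if `#{V ∧ PX} ≤ #{V ∧ QX}` on every up-set for `X = N, D, C`,
and if there is a red-ward injection `ψ` of the `B`-type inside parts into the `R`-type ones (the TRANSPORT), then
`#{V ∧ P} ≤ #{V ∧ Q}` on every up-set — part IV (`C041TriDomTwoCutCountMain`).  This part: the re-indexing of the
chord coordinate (`card_reindex_chord`: `o ↦ update o c₀ b` between the halves of `OutSupp`), the fibre counts and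
their halves (`fibC`, `fibH`), the cut-relation (`CutRel`), and the `N`- and `D`-fibres: the statement on `PN` / `PD`
at the up-set `fun ω => V (merge ω i)` bounds the fibre (`fib_N_le`, `fib_D_le`).
-/

namespace PercRepro

namespace ZoneZ

namespace MultiExit

open ZoneData Finset

section Count

variable {E₁ : Type} [Fintype E₁] [DecidableEq E₁] (In : E₁ → Prop) [DecidablePred In] (c₀ : E₁)

/-! ## The chord coordinate of an outside part -/

/-- Recolouring the chord keeps an outside part outside. -/
theorem update_mem_OutSupp (hc : ¬ In c₀) {o : E₁ → Bool} (ho : o ∈ OutSupp In) (b : Bool) :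
    Function.update o c₀ b ∈ OutSupp In := by
  unfold OutSupp at ho ⊢
  rw [Finset.mem_filter] at ho ⊢
  refine ⟨Finset.mem_univ _, fun e he => ?_⟩
  have hne : e ≠ c₀ := fun h => hc (by rw [← h]; exact he)
  rw [Function.update_of_ne hne]
  exact ho.2 e he

omit [Fintype E₁] in
/-- Recolouring the chord is monotone. -/
theorem leCol_update {o o' : E₁ → Bool} (h : LeCol o o') (b : Bool) :
    LeCol (Function.update o c₀ b) (Function.update o' c₀ b) := by
  intro e he
  by_cases hec : e = c₀
  · rw [hec, Function.update_self] at he ⊢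
    exact he
  · rw [Function.update_of_ne hec] at he ⊢
    exact h e he

open Classical in
/-- RE-INDEXING: the outside parts with the chord coloured `b₁`, read after recolouring the chord `b₂`, are the
outside parts with the chord coloured `b₂`. -/
theorem card_reindex_chord (hc : ¬ In c₀) (R : (E₁ → Bool) → Prop) (b₁ b₂ : Bool) :
    ((OutSupp In).filter fun o => o c₀ = b₁ ∧ R (Function.update o c₀ b₂)).card =
      ((OutSupp In).filter fun o => o c₀ = b₂ ∧ R o).card := by
  refine Finset.card_nbij' (fun o => Function.update o c₀ b₂) (fun o => Function.update o c₀ b₁) ?_ ?_ ?_ ?_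
  · intro o ho
    simp only [Finset.coe_filter, Set.mem_setOf_eq] at ho ⊢
    exact ⟨update_mem_OutSupp In c₀ hc ho.1 b₂, Function.update_self c₀ b₂ o, ho.2.2⟩
  · intro o ho
    simp only [Finset.coe_filter, Set.mem_setOf_eq] at ho ⊢
    refine ⟨update_mem_OutSupp In c₀ hc ho.1 b₁, Function.update_self c₀ b₁ o, ?_⟩
    rw [Function.update_idem, ← ho.2.1, Function.update_eq_self]
    exact ho.2.2
  · intro o ho
    simp only [Finset.coe_filter, Set.mem_setOf_eq] at ho
    simp only
    rw [Function.update_idem, ← ho.2.1, Function.update_eq_self]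
  · intro o ho
    simp only [Finset.coe_filter, Set.mem_setOf_eq] at ho
    simp only
    rw [Function.update_idem, ← ho.2.1, Function.update_eq_self]

/-! ## The fibre counts and their halves -/

open Classical in
/-- The fibre count over the inside part `i`. -/
noncomputable def fibC (V P : (E₁ → Bool) → Prop) (i : E₁ → Bool) : ℕ :=
  ((OutSupp In).filter fun o => V (merge In o i) ∧ P (merge In o i)).card

open Classical in
/-- The half of a fibre count with the chord coloured `b`. -/
noncomputable def fibH (V P : (E₁ → Bool) → Prop) (i : E₁ → Bool) (b : Bool) : ℕ :=
  ((OutSupp In).filter fun o => o c₀ = b ∧ V (merge In o i) ∧ P (merge In o i)).card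

open Classical in
/-- A fibre count is the sum of its two halves. -/
theorem fibC_eq_halves (V P : (E₁ → Bool) → Prop) (i : E₁ → Bool) :
    fibC In V P i = fibH In c₀ V P i true + fibH In c₀ V P i false := by
  unfold fibC fibH
  rw [← Finset.card_filter_add_card_filter_not (fun o => o c₀ = true)]
  congr 1
  · rw [Finset.filter_filter]
    exact card_filter_congr' fun o _ => and_comm
  · rw [Finset.filter_filter]
    refine card_filter_congr' fun o _ => ?_
    rw [Bool.not_eq_true]
    exact and_comm

open Classical in
/-- A count over all colourings is the sum of the fibre counts. -/
theorem card_eq_sum_fibC (V P : (E₁ → Bool) → Prop) :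
    (univ.filter fun ω => V ω ∧ P ω).card = ∑ i ∈ InSupp In, fibC In V P i := by
  rw [card_filter_inst.trans (card_filter_eq_sum_fibre In fun ω => V ω ∧ P ω)]
  rfl

/-! ## Cut-related predicates -/

variable (r bl : (E₁ → Bool) → Prop)

open Classical in
/-- `P` is CUT-RELATED to the outside-only predicates `PN, PD, PC`: on the `N`-fibres it is `PN` of the outside
part, on the `D`-fibres `PD`, on the `R`/`B`-fibres `PC` with the chord coloured by the red far connectivity. -/
structure CutRel (P PN PD PC : (E₁ → Bool) → Prop) : Prop where
  /-- the `N`-fibres -/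
  hN : ∀ o i, o ∈ OutSupp In → i ∈ InSupp In → ¬ r i → ¬ bl i → (P (merge In o i) ↔ PN o)
  /-- the `D`-fibres -/
  hD : ∀ o i, o ∈ OutSupp In → i ∈ InSupp In → r i → bl i → (P (merge In o i) ↔ PD o)
  /-- the `R`- and `B`-fibres -/
  hC : ∀ o i, o ∈ OutSupp In → i ∈ InSupp In → (bl i ↔ ¬ r i) →
    (P (merge In o i) ↔ PC (Function.update o c₀ (decide (r i))))
  /-- the reductions read only the outside part -/
  hout : ∀ ω, (PN ω ↔ PN (outN In ω)) ∧ (PD ω ↔ PD (outN In ω)) ∧ (PC ω ↔ PC (outN In ω))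

variable {In c₀ r bl}

open Classical in
/-- The `N`-fibres: the statement on the `N`-reductions bounds the fibre. -/
theorem fib_N_le {P PN PD PC Q QN QD QC : (E₁ → Bool) → Prop} (hP : CutRel In c₀ r bl P PN PD PC)
    (hQ : CutRel In c₀ r bl Q QN QD QC)
    (hN : ∀ V : (E₁ → Bool) → Prop, UpSet V →
      (univ.filter fun ω => V ω ∧ PN ω).card ≤ (univ.filter fun ω => V ω ∧ QN ω).card)
    {V : (E₁ → Bool) → Prop} (hV : UpSet V) {i : E₁ → Bool} (hi : i ∈ InSupp In) (hr : ¬ r i) (hb : ¬ bl i) :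
    fibC In V P i ≤ fibC In V Q i := by
  have key := hN (fun ω => V (merge In ω i)) (upSet_fibreOut In hV i)
  have hL : ∀ (X XN : (E₁ → Bool) → Prop), (∀ ω, XN ω ↔ XN (outN In ω)) →
      (∀ o, o ∈ OutSupp In → (X (merge In o i) ↔ XN o)) →
      (univ.filter fun ω => V (merge In ω i) ∧ XN ω).card = (InSupp In).card * fibC In V X i := by
    intro X XN hout hrel
    rw [card_filter_inst.trans (card_filter_outOnly In _ fun ω => ?_)]
    · unfold fibC
      congr 1
      exact card_filter_congr' fun o ho => and_congr_right fun _ => (hrel o ho).symm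
    · rw [merge_outN_left]
      exact and_congr_right fun _ => hout ω
  rw [hL P PN (fun ω => (hP.hout ω).1) (fun o ho => hP.hN o i ho hi hr hb),
    hL Q QN (fun ω => (hQ.hout ω).1) (fun o ho => hQ.hN o i ho hi hr hb)] at key
  exact Nat.le_of_mul_le_mul_left key (card_InSupp_pos In)

open Classical in
/-- The `D`-fibres: the statement on the `D`-reductions bounds the fibre. -/
theorem fib_D_le {P PN PD PC Q QN QD QC : (E₁ → Bool) → Prop} (hP : CutRel In c₀ r bl P PN PD PC)
    (hQ : CutRel In c₀ r bl Q QN QD QC)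
    (hD : ∀ V : (E₁ → Bool) → Prop, UpSet V →
      (univ.filter fun ω => V ω ∧ PD ω).card ≤ (univ.filter fun ω => V ω ∧ QD ω).card)
    {V : (E₁ → Bool) → Prop} (hV : UpSet V) {i : E₁ → Bool} (hi : i ∈ InSupp In) (hr : r i) (hb : bl i) :
    fibC In V P i ≤ fibC In V Q i := by
  have key := hD (fun ω => V (merge In ω i)) (upSet_fibreOut In hV i)
  have hL : ∀ (X XD : (E₁ → Bool) → Prop), (∀ ω, XD ω ↔ XD (outN In ω)) →
      (∀ o, o ∈ OutSupp In → (X (merge In o i) ↔ XD o)) →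
      (univ.filter fun ω => V (merge In ω i) ∧ XD ω).card = (InSupp In).card * fibC In V X i := by
    intro X XD hout hrel
    rw [card_filter_inst.trans (card_filter_outOnly In _ fun ω => ?_)]
    · unfold fibC
      congr 1
      exact card_filter_congr' fun o ho => and_congr_right fun _ => (hrel o ho).symm
    · rw [merge_outN_left]
      exact and_congr_right fun _ => hout ω
  rw [hL P PD (fun ω => (hP.hout ω).2.1) (fun o ho => hP.hD o i ho hi hr hb),
    hL Q QD (fun ω => (hQ.hout ω).2.1) (fun o ho => hQ.hD o i ho hi hr hb)] at key
  exact Nat.le_of_mul_le_mul_left key (card_InSupp_pos In)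

end Count

end MultiExit

end ZoneZ

end PercRepro
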